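import Literature.Probability.RandomPlanarGeometry.SAWPulledLargeForceExpansionZdSixStep
import HarnessLib

/-!
# The pulled self-avoiding walk on `ℤ^{d+1}` at large force: the cost-six irreducible bridges of length seven
# (`N_{6,7} = 64d⁶ − 160d⁵ + 112d⁴ + 20d² − 34d`, the number of six-step self-avoiding walks of `ℤ^d`)

Topic `Literature/Probability/RandomPlanarGeometry` (continues `SAWPulledLargeForceExpansionZdSixStep.lean`: `sixStepIndex`, `sixStep`,
`eq_sixStep_of_mem`, `card_sixStepIndex_add`, and `SAWPulledLargeForceExpansionZdFourthOrder.lean`: the four-vector lemma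
`eq_revIdx_of_sum_four_eq_zero`, the inner products `sum_twoStepV_mul`, `sum_twoStepV_mul_twoStepV_cases`).

Printed sources: N. Madras, G. Slade, *The Self-Avoiding Walk* (1993), §1.1 p. 3 (`c₁ … c₄` as polynomials in `d`), §1.2, §4.2
(irreducible bridges), Appendix C, Table C.1, p. 394 (`c_6(ℤ²) = 780`, `c_6(ℤ³) = 16 926`) and Table C.4, p. 397 (`c_6(ℤ⁴) = 127 160`,
`c_6(ℤ⁵) = 570 330`, `c_6(ℤ⁶) = 1 887 492`, "taken from Fisher and Gaunt (1964)"). Since `c_6(ℤ^d)` is a polynomial in `d` of degree at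
most six, these printed values together with `c_6(ℤ⁰) = 0`, `c_6(ℤ¹) = 2` determine it: `c_6 = 64d⁶ − 160d⁵ + 112d⁴ + 20d² − 34d`, the
polynomial proved here for every `d` (the theorem reproduces all seven values). The cost-six census at length seven as an identity of
closer families is not in print (lane «pcv-sawmu»).

## Contents (all PROVED, standard axioms only; no data, no certificates)

* six transverse unit steps summing to zero contain the reversal of the first one (`exists_eq_revIdx_of_sum_six_eq_zero`, inner product
  with `v₁`);
* the cost-six irreducible bridges of length seven are the one-step extensions `(s, g)` of the five-step transverse self-avoiding walks
  `s ∈ sixStepIndex` by a sixth transverse step `g` that is not a reversal, closes no unit square on steps `3–6` and does not close the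
  hexagon (`sevenIndex`, `sevenStep`, `sevenStep_mem_filter`, ★ `eq_sevenStep_of_mem`, `sevenStep_injective`);
* the three excluded families are disjoint and counted: reversals `#sixStepIndex`, square closers `2d(2d−1)(2d−2)²` (`card_sqClose`),
  hexagon closers = rooted directed six-step self-avoiding polygons `2d(2d−2)(8d−13)` (`card_hexClose`: four explicit families
  `(a,b,−a,e,−b,−e)`, `(a,b,c,−a,−b,−c)`, `(a,b,c,−a,−c,−b)`, `(a,b,c,−b,−a,−c)`);
* ★ `costCoeffZd_six_seven_add` (subtraction-free) and ★ `costCoeffZd_six_seven : N_{6,7} = 64d⁶ − 160d⁵ + 112d⁴ + 20d² − 34d`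
  (`d = 1, 2, 3`: `2, 780, 16 926`).

Provenance: lane «pcv-sawmu», a-p3 g17 (2026-08-25); ed.2 = ed.1 + the Table C.4 values in two docstrings (lit-1 g24 ZS-1).
-/

noncomputable section

open Finset
open scoped BigOperators
open Literature.Probability.LatticeModels
open Literature.Probability.RandomPlanarGeometry.SAW

namespace Literature.Probability.RandomPlanarGeometry.SAW.Zd

/-- A transverse step index of `ℤ^{d+1}`: axis and sign. [cite: MadrasSlade1993, Definition 1.2.4] -/
abbrev Idx (d : ℕ) := Fin d × Bool

/-- Five transverse step indices. [cite: MadrasSlade1993, Definition 1.2.4] -/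
abbrev Idx5 (d : ℕ) := Idx d × Idx d × Idx d × Idx d × Idx d

/-! ### Counting helpers -/

/-- `#(Fin d × Bool) = 2d`. [cite: MadrasSlade1993, §1.2] -/
theorem card_idx (d : ℕ) : Fintype.card (Idx d) = 2 * d := by
  rw [Fintype.card_prod, Fintype.card_fin, Fintype.card_bool, mul_comm]

/-- `#{b : b ∉ {x, y, z}} = 2d − 3` for distinct `x, y, z`. [cite: MadrasSlade1993, §1.2] -/
theorem card_filter_ne_three_idx (d : ℕ) {x y z : Idx d} (hxy : x ≠ y) (hxz : x ≠ z) (hyz : y ≠ z) :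
    (Finset.univ.filter fun b : Idx d => b ≠ x ∧ b ≠ y ∧ b ≠ z).card = 2 * d - 3 := by
  classical
  have : (Finset.univ.filter fun b : Idx d => b ≠ x ∧ b ≠ y ∧ b ≠ z) = Finset.univ \ {x, y, z} := by
    ext b; simp [not_or]
  rw [this, Finset.card_sdiff_of_subset (Finset.subset_univ _), Finset.card_univ, card_idx,
    Finset.card_insert_of_notMem (by simp [hxy, hxz]), Finset.card_pair hyz]

/-- `#{b : b ∉ {x, y, z, w}} = 2d − 4` for distinct `x, y, z, w`. [cite: MadrasSlade1993, §1.2] -/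
theorem card_filter_ne_four_idx (d : ℕ) {x y z w : Idx d} (hxy : x ≠ y) (hxz : x ≠ z) (hxw : x ≠ w) (hyz : y ≠ z) (hyw : y ≠ w)
    (hzw : z ≠ w) : (Finset.univ.filter fun b : Idx d => b ≠ x ∧ b ≠ y ∧ b ≠ z ∧ b ≠ w).card = 2 * d - 4 := by
  classical
  have : (Finset.univ.filter fun b : Idx d => b ≠ x ∧ b ≠ y ∧ b ≠ z ∧ b ≠ w) = Finset.univ \ {x, y, z, w} := by
    ext b; simp [not_or]
  rw [this, Finset.card_sdiff_of_subset (Finset.subset_univ _), Finset.card_univ, card_idx,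
    Finset.card_insert_of_notMem (by simp [hxy, hxz, hxw]), Finset.card_insert_of_notMem (by simp [hyz, hyw]), Finset.card_pair hzw]

/-- `#{(a, b) : p (a, b)} = Σ_a #{b : p (a, b)}`. [cite: MadrasSlade1993, §1.2] -/
theorem card_filter_univ_prod {α β : Type*} [Fintype α] [Fintype β] (p : α × β → Prop) [DecidablePred p] :
    ((Finset.univ : Finset (α × β)).filter p).card = ∑ a, (Finset.univ.filter fun b => p (a, b)).card := by
  rw [← Finset.univ_product_univ, Finset.card_filter, Finset.sum_product]
  exact Finset.sum_congr rfl fun a _ => by rw [Finset.card_filter]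

/-- `Σ_b [q b]·c = #{b : q b}·c`. [cite: MadrasSlade1993, §1.2] -/
theorem sum_ite_const_nat {β : Type*} [Fintype β] (q : β → Prop) [DecidablePred q] (c : ℕ) :
    (∑ b, if q b then c else 0) = (Finset.univ.filter q).card * c := by
  rw [Finset.sum_ite, Finset.sum_const_zero, add_zero, Finset.sum_const, smul_eq_mul]

/-- `#{b : C ∧ q b} = [C]·#{b : q b}`. [cite: MadrasSlade1993, §1.2] -/
theorem card_filter_const_and {β : Type*} [Fintype β] (C : Prop) [Decidable C] (q : β → Prop) [DecidablePred q] :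
    (Finset.univ.filter fun b => C ∧ q b).card = if C then (Finset.univ.filter q).card else 0 := by
  by_cases h : C <;> simp [h]

/-! ### Six transverse unit steps summing to zero -/

/-- ★ If six transverse unit steps sum to zero, one of the last five is the reversal of the first (take the inner product with `v_a`:
`1 + Σ ⟨v_a, v_x⟩ = 0` forces some `⟨v_a, v_x⟩ = −1`). [cite: MadrasSlade1993, Definition 1.2.4] -/
theorem exists_eq_revIdx_of_sum_six_eq_zero (d : ℕ) {a b c e f g : Idx d}
    (h : twoStepV d a + twoStepV d b + twoStepV d c + twoStepV d e + twoStepV d f + twoStepV d g = 0) :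
    b = revIdx a ∨ c = revIdx a ∨ e = revIdx a ∨ f = revIdx a ∨ g = revIdx a := by
  by_contra hne
  simp only [not_or] at hne
  obtain ⟨hb, hc, he, hf, hg⟩ := hne
  have hφ := congrArg (fun v : Site (d + 1) => ∑ i, twoStepV d a i * v i) h
  simp only [Pi.add_apply, Pi.zero_apply, mul_add, mul_zero, Finset.sum_const_zero, Finset.sum_add_distrib] at hφ
  rw [sum_twoStepV_mul_self] at hφ
  have h1 := (sum_twoStepV_mul_twoStepV_cases d a b).1 hb
  have h2 := (sum_twoStepV_mul_twoStepV_cases d a c).1 hc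
  have h3 := (sum_twoStepV_mul_twoStepV_cases d a e).1 he
  have h4 := (sum_twoStepV_mul_twoStepV_cases d a f).1 hf
  have h5 := (sum_twoStepV_mul_twoStepV_cases d a g).1 hg
  linarith

/-- `v_a + v_{−a} = 0`. [cite: MadrasSlade1993, Definition 1.2.4] -/
theorem twoStepV_add_revIdx (d : ℕ) (a : Idx d) : twoStepV d a + twoStepV d (revIdx a) = 0 := by
  rcases a with ⟨j, b⟩
  rw [revIdx, twoStepV_not, add_neg_cancel]

/-- `v_{−a} = −v_a`. [cite: MadrasSlade1993, Definition 1.2.4] -/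
theorem twoStepV_revIdx (d : ℕ) (a : Idx d) : twoStepV d (revIdx a) = -twoStepV d a := by
  rcases a with ⟨j, b⟩
  rw [revIdx, twoStepV_not]

/-- `v_a + v_b = 0 ↔ b = −a`. [cite: MadrasSlade1993, Definition 1.2.4] -/
theorem twoStepV_add_eq_zero_iff (d : ℕ) (a b : Idx d) : twoStepV d a + twoStepV d b = 0 ↔ b = revIdx a := by
  constructor
  · intro h; exact twoStepV_add_eq_zero d h
  · rintro rfl; exact twoStepV_add_revIdx d a

/-- `b ≠ −a → a ≠ −b`. [cite: MadrasSlade1993, Definition 1.2.4] -/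
theorem ne_revIdx_symm {d : ℕ} {a b : Idx d} (h : b ≠ revIdx a) : a ≠ revIdx b := by
  intro h'
  rw [h', revIdx_revIdx] at h
  exact h rfl

/-! ### The index set of the cost-six irreducible bridges of length seven -/

/-- Decidable equality of `Idx5 d × Idx d`. [cite: MadrasSlade1993, §1.2] -/
instance instDecidableEqIdx6 (d : ℕ) : DecidableEq (Idx5 d × Idx d) := instDecidableEqProd

/-- The three partial step sums deciding self-avoidance of the extension `(s, g)`: steps `3–6` and `1–6`.
[cite: MadrasSlade1993, Definition 1.2.4] -/
def sum4 (d : ℕ) (p : Idx5 d × Idx d) : Site (d + 1) :=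
  twoStepV d p.1.2.2.1 + twoStepV d p.1.2.2.2.1 + twoStepV d p.1.2.2.2.2 + twoStepV d p.2

/-- The total transverse displacement of `(s, g)`. [cite: MadrasSlade1993, Definition 1.2.4] -/
def sum6 (d : ℕ) (p : Idx5 d × Idx d) : Site (d + 1) :=
  twoStepV d p.1.1 + twoStepV d p.1.2.1 + twoStepV d p.1.2.2.1 + twoStepV d p.1.2.2.2.1 + twoStepV d p.1.2.2.2.2 + twoStepV d p.2

/-- All one-step extensions of the five-step transverse self-avoiding walks. [cite: MadrasSlade1993, §1.2] -/
def ext6 (d : ℕ) : Finset (Idx5 d × Idx d) := sixStepIndex d ×ˢ Finset.univ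

/-- Extensions by an immediate reversal. [cite: MadrasSlade1993, §1.2] -/
def revClose (d : ℕ) : Finset (Idx5 d × Idx d) := (ext6 d).filter fun p => p.2 = revIdx p.1.2.2.2.2

/-- Extensions closing a unit square on steps `3–6`. [cite: MadrasSlade1993, §1.2] -/
def sqClose (d : ℕ) : Finset (Idx5 d × Idx d) := (ext6 d).filter fun p => sum4 d p = 0

/-- Extensions closing the hexagon (rooted directed six-step self-avoiding polygons). [cite: MadrasSlade1993, §1.2] -/
def hexClose (d : ℕ) : Finset (Idx5 d × Idx d) := (ext6 d).filter fun p => sum6 d p = 0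

/-- ★ The index set of the cost-six irreducible bridges of length seven: extensions that are not reversals and close neither a square nor
the hexagon. [cite: MadrasSlade1993, §1.2] -/
def sevenIndex (d : ℕ) : Finset (Idx5 d × Idx d) :=
  (ext6 d).filter fun p => ¬ (p.2 = revIdx p.1.2.2.2.2 ∨ sum4 d p = 0 ∨ sum6 d p = 0)

/-- `#ext6 = 2d · #sixStepIndex`. [cite: MadrasSlade1993, §1.2] -/
theorem card_ext6 (d : ℕ) : (ext6 d).card = (sixStepIndex d).card * (2 * d) := by
  rw [ext6, Finset.card_product, Finset.card_univ, card_idx]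

/-- `#sevenIndex + #(revClose ∪ sqClose ∪ hexClose) = #ext6`. [cite: MadrasSlade1993, §1.2] -/
theorem card_sevenIndex_add (d : ℕ) :
    (sevenIndex d).card + (revClose d ∪ sqClose d ∪ hexClose d).card = (sixStepIndex d).card * (2 * d) := by
  have hu : revClose d ∪ sqClose d ∪ hexClose d = (ext6 d).filter fun p => p.2 = revIdx p.1.2.2.2.2 ∨ sum4 d p = 0 ∨ sum6 d p = 0 := by
    rw [revClose, sqClose, hexClose, Finset.filter_or, Finset.filter_or, Finset.union_assoc]
  rw [hu, sevenIndex, add_comm, Finset.card_filter_add_card_filter_not, card_ext6]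


/-! ### Membership -/

/-- Membership in `ext6`. [cite: MadrasSlade1993, §1.2] -/
theorem mem_ext6 {d : ℕ} {p : Idx5 d × Idx d} : p ∈ ext6 d ↔ p.1 ∈ sixStepIndex d := by
  simp [ext6, Finset.mem_product]

/-- Membership in `hexClose`. [cite: MadrasSlade1993, §1.2] -/
theorem mem_hexClose {d : ℕ} {p : Idx5 d × Idx d} : p ∈ hexClose d ↔ p.1 ∈ sixStepIndex d ∧ sum6 d p = 0 := by
  rw [hexClose, Finset.mem_filter, mem_ext6]

/-- Membership in `sqClose`. [cite: MadrasSlade1993, §1.2] -/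
theorem mem_sqClose {d : ℕ} {p : Idx5 d × Idx d} : p ∈ sqClose d ↔ p.1 ∈ sixStepIndex d ∧ sum4 d p = 0 := by
  rw [sqClose, Finset.mem_filter, mem_ext6]

/-- Membership in `revClose`. [cite: MadrasSlade1993, §1.2] -/
theorem mem_revClose {d : ℕ} {p : Idx5 d × Idx d} : p ∈ revClose d ↔ p.1 ∈ sixStepIndex d ∧ p.2 = revIdx p.1.2.2.2.2 := by
  rw [revClose, Finset.mem_filter, mem_ext6]

/-! ### The reversals: `#revClose = #sixStepIndex` -/

/-- `revClose` is the graph of `s ↦ −v₅`. [cite: MadrasSlade1993, §1.2] -/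
theorem revClose_eq_image (d : ℕ) : revClose d = (sixStepIndex d).image fun s => (s, revIdx s.2.2.2.2) := by
  ext ⟨s, g⟩
  simp only [mem_revClose, Finset.mem_image, Prod.mk.injEq]
  constructor
  · rintro ⟨hs, rfl⟩; exact ⟨s, hs, rfl, rfl⟩
  · rintro ⟨s', hs', rfl, rfl⟩; exact ⟨hs', rfl⟩

/-- `#revClose = #sixStepIndex`. [cite: MadrasSlade1993, §1.2] -/
theorem card_revClose (d : ℕ) : (revClose d).card = (sixStepIndex d).card := by
  rw [revClose_eq_image, Finset.card_image_of_injective _ (fun s s' h => (Prod.mk.inj h).1)]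

/-! ### The square closers: `(a, b, c, e, −c; −e)` -/

/-- Parameters of the square closers: `(a, b, c, e)` with `b ≠ −a`, `c ≠ −b`, `e ∉ {−c, c, −b}`. [cite: MadrasSlade1993, §1.2] -/
def sqParam (d : ℕ) : Finset (Idx d × Idx d × Idx d × Idx d) :=
  Finset.univ.filter fun t => t.2.1 ≠ revIdx t.1 ∧ t.2.2.1 ≠ revIdx t.2.1 ∧
    (t.2.2.2 ≠ revIdx t.2.2.1 ∧ t.2.2.2 ≠ t.2.2.1 ∧ t.2.2.2 ≠ revIdx t.2.1)

/-- The square closer with parameters `(a, b, c, e)`. [cite: MadrasSlade1993, §1.2] -/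
def sqMap {d : ℕ} (t : Idx d × Idx d × Idx d × Idx d) : Idx5 d × Idx d :=
  ((t.1, t.2.1, t.2.2.1, t.2.2.2, revIdx t.2.2.1), revIdx t.2.2.2)

/-- ★ The square closers are exactly `((a, b, c, e, −c), −e)` with `(a, b, c, e) ∈ sqParam` (four-vector lemma on steps `3–6`).
[cite: MadrasSlade1993, §1.2] -/
theorem sqClose_eq_image (d : ℕ) : sqClose d = (sqParam d).image sqMap := by
  ext ⟨⟨a, b, c, e, f⟩, g⟩
  simp only [mem_sqClose, mem_sixStepIndex, Finset.mem_image, sum4]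
  constructor
  · rintro ⟨⟨⟨h12, h23, h34, h45⟩, -, hsqB⟩, hsum⟩
    obtain ⟨hfc, hge⟩ := eq_revIdx_of_sum_four_eq_zero d h34 h45 hsum
    refine ⟨(a, b, c, e), ?_, ?_⟩
    · simp only [sqParam, Finset.mem_filter, Finset.mem_univ, true_and]
      refine ⟨h12, h23, h34, ?_, ?_⟩
      · rintro rfl; exact h45 hfc
      · intro heb; exact hsqB ⟨heb, hfc⟩
    · simp only [sqMap, hfc, hge]
  · rintro ⟨⟨a', b', c', e'⟩, ht, hEq⟩
    simp only [sqParam, Finset.mem_filter, Finset.mem_univ, true_and] at ht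
    simp only [sqMap, Prod.mk.injEq] at hEq
    obtain ⟨h12, h23, h34, hec, heb⟩ := ht
    obtain ⟨⟨rfl, rfl, rfl, rfl, rfl⟩, rfl⟩ := hEq
    refine ⟨⟨⟨h12, h23, h34, fun h => hec (revIdx_inj h).symm⟩, fun h => heb h.2, fun h => heb h.1⟩, ?_⟩
    rw [twoStepV_revIdx, twoStepV_revIdx]; abel

/-- `sqMap` is injective. [cite: MadrasSlade1993, §1.2] -/
theorem sqMap_injective (d : ℕ) : Function.Injective (sqMap (d := d)) := by
  rintro ⟨a, b, c, e⟩ ⟨a', b', c', e'⟩ h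
  simp only [sqMap, Prod.mk.injEq] at h
  obtain ⟨⟨rfl, rfl, rfl, rfl, -⟩, -⟩ := h
  rfl

/-- `#sqParam = 2d(2d−1)(2d−2)²` (for `c = b` the last step avoids `{b, −b}`, otherwise `{−c, c, −b}`). [cite: MadrasSlade1993, §1.2] -/
theorem card_sqParam (d : ℕ) : (sqParam d).card = 2 * d * (2 * d - 1) * (2 * d - 2) ^ 2 := by
  classical
  have hA : (Finset.univ : Finset (Idx d)).card = 2 * d := by rw [Finset.card_univ, card_idx]
  -- innermost count
  have h3 : ∀ b c : Idx d, c ≠ revIdx b →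
      (Finset.univ.filter fun e : Idx d => e ≠ revIdx c ∧ e ≠ c ∧ e ≠ revIdx b).card = if c = b then 2 * d - 2 else 2 * d - 3 := by
    intro b c hcb
    split_ifs with hc
    · subst hc
      have : (Finset.univ.filter fun e : Idx d => e ≠ revIdx c ∧ e ≠ c ∧ e ≠ revIdx c) =
          Finset.univ.filter fun e : Idx d => e ≠ revIdx c ∧ e ≠ c := by
        ext e; simp only [Finset.mem_filter, Finset.mem_univ, true_and]; tauto
      rw [this, card_filter_ne_ne_idx d (revIdx_ne_self c)]
    · exact card_filter_ne_three_idx d (revIdx_ne_self c) (fun h => hc (revIdx_inj h)) hcb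
  have h2 : ∀ a b : Idx d, (Finset.univ.filter fun t : Idx d × Idx d => b ≠ revIdx a ∧ t.1 ≠ revIdx b ∧
      (t.2 ≠ revIdx t.1 ∧ t.2 ≠ t.1 ∧ t.2 ≠ revIdx b)).card = if b ≠ revIdx a then (2 * d - 2) + (2 * d - 2) * (2 * d - 3) else 0 := by
    intro a b
    rw [card_filter_univ_prod]
    simp only [card_filter_const_and]
    split_ifs with hba
    · have : ∀ c : Idx d, (if c ≠ revIdx b then (Finset.univ.filter fun e : Idx d => e ≠ revIdx c ∧ e ≠ c ∧ e ≠ revIdx b).card else 0) =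
          (if c = b then 2 * d - 2 else 0) + (if c ≠ b ∧ c ≠ revIdx b then 2 * d - 3 else 0) := by
        intro c
        by_cases hcb : c = revIdx b
        · rw [if_neg (not_not.2 hcb), if_neg (by rw [hcb]; exact revIdx_ne_self b), if_neg (fun h => h.2 hcb)]
        · rw [if_pos hcb, h3 b c hcb]
          by_cases hc : c = b
          · rw [if_pos hc, if_pos hc, if_neg (fun h => h.1 hc), add_zero]
          · rw [if_neg hc, if_neg hc, if_pos ⟨hc, hcb⟩, zero_add]
      rw [Finset.sum_congr rfl fun c _ => this c, Finset.sum_add_distrib, Finset.sum_ite_eq' Finset.univ b, if_pos (Finset.mem_univ b),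
        sum_ite_const_nat, card_filter_ne_ne_idx d (revIdx_ne_self b).symm]
    · simp
  have h1 : ∀ a : Idx d, (Finset.univ.filter fun t : Idx d × Idx d × Idx d => t.1 ≠ revIdx a ∧ t.2.1 ≠ revIdx t.1 ∧
      (t.2.2 ≠ revIdx t.2.1 ∧ t.2.2 ≠ t.2.1 ∧ t.2.2 ≠ revIdx t.1)).card = (2 * d - 1) * ((2 * d - 2) + (2 * d - 2) * (2 * d - 3)) := by
    intro a
    rw [card_filter_univ_prod]
    simp only [h2]
    rw [sum_ite_const_nat, card_filter_ne_idx]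
  rw [sqParam, card_filter_univ_prod]
  simp only [h1]
  rw [Finset.sum_const, smul_eq_mul, hA]
  rcases Nat.lt_or_ge d 2 with hd | hd
  · interval_cases d <;> rfl
  · obtain ⟨k, rfl⟩ := Nat.exists_eq_add_of_le hd
    have e1 : 2 * (2 + k) - 1 = 2 * k + 3 := by omega
    have e2 : 2 * (2 + k) - 2 = 2 * k + 2 := by omega
    have e3 : 2 * (2 + k) - 3 = 2 * k + 1 := by omega
    rw [e1, e2, e3]; ring

/-- `#sqClose = 2d(2d−1)(2d−2)²`. [cite: MadrasSlade1993, §1.2] -/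
theorem card_sqClose (d : ℕ) : (sqClose d).card = 2 * d * (2 * d - 1) * (2 * d - 2) ^ 2 := by
  rw [sqClose_eq_image, Finset.card_image_of_injective _ (sqMap_injective d), card_sqParam]

/-! ### The hexagon closers: rooted directed six-step self-avoiding polygons -/

/-- Leaf 1: `(a, b, −a, e, −b; −e)`, `b ∉ {a, −a}`, `e ∉ {a, b, −b}`. [cite: MadrasSlade1993, §1.2] -/
def hexParam1 (d : ℕ) : Finset (Idx d × Idx d × Idx d) :=
  Finset.univ.filter fun t => (t.2.1 ≠ t.1 ∧ t.2.1 ≠ revIdx t.1) ∧ (t.2.2 ≠ t.1 ∧ t.2.2 ≠ t.2.1 ∧ t.2.2 ≠ revIdx t.2.1)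

/-- The leaf-1 hexagon. [cite: MadrasSlade1993, §1.2] -/
def hexMap1 {d : ℕ} (t : Idx d × Idx d × Idx d) : Idx5 d × Idx d :=
  ((t.1, t.2.1, revIdx t.1, t.2.2, revIdx t.2.1), revIdx t.2.2)

/-- Leaf 2a: `(a, a, c, −a, −a; −c)`, `c ∉ {a, −a}`. [cite: MadrasSlade1993, §1.2] -/
def hexParam2a (d : ℕ) : Finset (Idx d × Idx d) :=
  Finset.univ.filter fun t => t.2 ≠ t.1 ∧ t.2 ≠ revIdx t.1

/-- The leaf-2a hexagon. [cite: MadrasSlade1993, §1.2] -/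
def hexMap2a {d : ℕ} (t : Idx d × Idx d) : Idx5 d × Idx d :=
  ((t.1, t.1, t.2, revIdx t.1, revIdx t.1), revIdx t.2)

/-- Leaves 2b: `(a, b, c, −a, −b; −c)`, `b ∉ {a, −a}`, `c ∉ {a, −a, −b}`. [cite: MadrasSlade1993, §1.2] -/
def hexParam2b (d : ℕ) : Finset (Idx d × Idx d × Idx d) :=
  Finset.univ.filter fun t => (t.2.1 ≠ t.1 ∧ t.2.1 ≠ revIdx t.1) ∧ (t.2.2 ≠ t.1 ∧ t.2.2 ≠ revIdx t.1 ∧ t.2.2 ≠ revIdx t.2.1)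

/-- The leaf-2b hexagon. [cite: MadrasSlade1993, §1.2] -/
def hexMap2b {d : ℕ} (t : Idx d × Idx d × Idx d) : Idx5 d × Idx d :=
  ((t.1, t.2.1, t.2.2, revIdx t.1, revIdx t.2.1), revIdx t.2.2)

/-- Leaves 3 and 4: `b ∉ {a, −a}`, `c ∉ {a, −a, b, −b}`. [cite: MadrasSlade1993, §1.2] -/
def hexParam34 (d : ℕ) : Finset (Idx d × Idx d × Idx d) :=
  Finset.univ.filter fun t => (t.2.1 ≠ t.1 ∧ t.2.1 ≠ revIdx t.1) ∧
    (t.2.2 ≠ t.1 ∧ t.2.2 ≠ revIdx t.1 ∧ t.2.2 ≠ t.2.1 ∧ t.2.2 ≠ revIdx t.2.1)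

/-- The leaf-3 hexagon `(a, b, c, −a, −c; −b)`. [cite: MadrasSlade1993, §1.2] -/
def hexMap3 {d : ℕ} (t : Idx d × Idx d × Idx d) : Idx5 d × Idx d :=
  ((t.1, t.2.1, t.2.2, revIdx t.1, revIdx t.2.2), revIdx t.2.1)

/-- The leaf-4 hexagon `(a, b, c, −b, −a; −c)`. [cite: MadrasSlade1993, §1.2] -/
def hexMap4 {d : ℕ} (t : Idx d × Idx d × Idx d) : Idx5 d × Idx d :=
  ((t.1, t.2.1, t.2.2, revIdx t.2.1, revIdx t.1), revIdx t.2.2)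

/-- Leaf 1 of `hexClose` (`v₃ = −v₁`) is the image of `hexMap1`. [cite: MadrasSlade1993, §1.2] -/
theorem hexClose_leaf1 (d : ℕ) :
    (hexClose d).filter (fun p => p.1.2.2.1 = revIdx p.1.1) = (hexParam1 d).image hexMap1 := by
  ext ⟨⟨a, b, c, e, f⟩, g⟩
  simp only [Finset.mem_filter, mem_hexClose, mem_sixStepIndex, Finset.mem_image, sum6]
  constructor
  · rintro ⟨⟨⟨⟨h12, h23, h34, h45⟩, hsqA, -⟩, hsum⟩, hca⟩
    subst hca
    have h4 : twoStepV d b + twoStepV d e + twoStepV d f + twoStepV d g = 0 := by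
      rw [twoStepV_revIdx] at hsum; rw [← hsum]; abel
    have heb : e ≠ revIdx b := fun h => hsqA ⟨rfl, h⟩
    obtain ⟨hfb, hge⟩ := eq_revIdx_of_sum_four_eq_zero d heb h45 h4
    refine ⟨(a, b, e), ?_, ?_⟩
    · simp only [hexParam1, Finset.mem_filter, Finset.mem_univ, true_and]
      refine ⟨⟨?_, h12⟩, ?_, ?_, heb⟩
      · rintro rfl; exact h23 rfl
      · intro h; rw [h, revIdx_revIdx] at h34; exact h34 rfl
      · rintro rfl; exact h45 hfb
    · simp only [hexMap1, hfb, hge]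
  · rintro ⟨⟨a', b', e'⟩, ht, hEq⟩
    simp only [hexParam1, Finset.mem_filter, Finset.mem_univ, true_and] at ht
    simp only [hexMap1, Prod.mk.injEq] at hEq
    obtain ⟨⟨hba, hba'⟩, hea, heb, heb'⟩ := ht
    obtain ⟨⟨rfl, rfl, rfl, rfl, rfl⟩, rfl⟩ := hEq
    refine ⟨⟨⟨⟨hba', fun h => hba (revIdx_inj h).symm, ?_, fun h => heb (revIdx_inj h).symm⟩,
      fun h => heb' h.2, fun h => heb' h.1⟩, ?_⟩, rfl⟩
    · rw [revIdx_revIdx]; exact hea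
    · rw [twoStepV_revIdx, twoStepV_revIdx, twoStepV_revIdx]; abel

/-- Leaf 2a of `hexClose` (`v₃ ≠ −v₁`, `v₄ = −v₁`, `v₅ = −v₂`, `v₂ = v₁`) is the image of `hexMap2a`. [cite: MadrasSlade1993, §1.2] -/
theorem hexClose_leaf2a (d : ℕ) :
    (hexClose d).filter (fun p => ((¬ p.1.2.2.1 = revIdx p.1.1 ∧ p.1.2.2.2.1 = revIdx p.1.1) ∧
      p.1.2.2.2.2 = revIdx p.1.2.1) ∧ p.1.2.1 = p.1.1) = (hexParam2a d).image hexMap2a := by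
  ext ⟨⟨a, b, c, e, f⟩, g⟩
  simp only [Finset.mem_filter, mem_hexClose, mem_sixStepIndex, Finset.mem_image, sum6]
  constructor
  · rintro ⟨⟨⟨⟨-, -, h34, -⟩, -, -⟩, hsum⟩, ⟨⟨hca, hea⟩, hfb⟩, hba⟩
    subst hea hfb hba
    have h2 : twoStepV d c + twoStepV d g = 0 := by
      rw [twoStepV_revIdx] at hsum; rw [← hsum]; abel
    have hgc : g = revIdx c := twoStepV_add_eq_zero d h2
    refine ⟨(b, c), ?_, ?_⟩
    · simp only [hexParam2a, Finset.mem_filter, Finset.mem_univ, true_and]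
      refine ⟨?_, hca⟩
      intro h; rw [h] at h34; exact h34 rfl
    · simp only [hexMap2a, hgc]
  · rintro ⟨⟨a', c'⟩, ht, hEq⟩
    simp only [hexParam2a, Finset.mem_filter, Finset.mem_univ, true_and] at ht
    simp only [hexMap2a, Prod.mk.injEq] at hEq
    obtain ⟨hca, hca'⟩ := ht
    obtain ⟨⟨rfl, rfl, rfl, rfl, rfl⟩, rfl⟩ := hEq
    refine ⟨⟨⟨⟨(revIdx_ne_self _).symm, hca', fun h => hca (revIdx_inj h).symm, ?_⟩, fun h => hca' h.1,
      fun h => hca (revIdx_inj h.2).symm⟩, ?_⟩, ⟨⟨hca', rfl⟩, rfl⟩, rfl⟩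
    · rw [revIdx_revIdx]; exact revIdx_ne_self _
    · rw [twoStepV_revIdx, twoStepV_revIdx]; abel

/-- Leaf 2b of `hexClose` (`v₃ ≠ −v₁`, `v₄ = −v₁`, `v₅ = −v₂`, `v₂ ≠ v₁`) is the image of `hexMap2b`. [cite: MadrasSlade1993, §1.2] -/
theorem hexClose_leaf2b (d : ℕ) :
    (hexClose d).filter (fun p => ((¬ p.1.2.2.1 = revIdx p.1.1 ∧ p.1.2.2.2.1 = revIdx p.1.1) ∧
      p.1.2.2.2.2 = revIdx p.1.2.1) ∧ ¬ p.1.2.1 = p.1.1) = (hexParam2b d).image hexMap2b := by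
  ext ⟨⟨a, b, c, e, f⟩, g⟩
  simp only [Finset.mem_filter, mem_hexClose, mem_sixStepIndex, Finset.mem_image, sum6]
  constructor
  · rintro ⟨⟨⟨⟨h12, h23, h34, -⟩, -, -⟩, hsum⟩, ⟨⟨hca, hea⟩, hfb⟩, hba⟩
    subst hea hfb
    have h2 : twoStepV d c + twoStepV d g = 0 := by
      rw [twoStepV_revIdx, twoStepV_revIdx] at hsum; rw [← hsum]; abel
    have hgc : g = revIdx c := twoStepV_add_eq_zero d h2
    refine ⟨(a, b, c), ?_, ?_⟩
    · simp only [hexParam2b, Finset.mem_filter, Finset.mem_univ, true_and]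
      refine ⟨⟨hba, h12⟩, ?_, hca, h23⟩
      intro h; rw [h] at h34; exact h34 rfl
    · simp only [hexMap2b, hgc]
  · rintro ⟨⟨a', b', c'⟩, ht, hEq⟩
    simp only [hexParam2b, Finset.mem_filter, Finset.mem_univ, true_and] at ht
    simp only [hexMap2b, Prod.mk.injEq] at hEq
    obtain ⟨⟨hba, hba'⟩, hca, hca', hcb'⟩ := ht
    obtain ⟨⟨rfl, rfl, rfl, rfl, rfl⟩, rfl⟩ := hEq
    refine ⟨⟨⟨⟨hba', hcb', fun h => hca (revIdx_inj h).symm, ?_⟩, fun h => hca' h.1,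
      fun h => hba (revIdx_inj h.1).symm⟩, ?_⟩, ⟨⟨hca', rfl⟩, rfl⟩, hba⟩
    · rw [revIdx_revIdx]; exact (ne_revIdx_symm hba').symm
    · rw [twoStepV_revIdx, twoStepV_revIdx, twoStepV_revIdx]; abel

/-- Leaf 3 of `hexClose` (`v₃ ≠ −v₁`, `v₄ = −v₁`, `v₅ ≠ −v₂`) is the image of `hexMap3`. [cite: MadrasSlade1993, §1.2] -/
theorem hexClose_leaf3 (d : ℕ) :
    (hexClose d).filter (fun p => (¬ p.1.2.2.1 = revIdx p.1.1 ∧ p.1.2.2.2.1 = revIdx p.1.1) ∧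
      ¬ p.1.2.2.2.2 = revIdx p.1.2.1) = (hexParam34 d).image hexMap3 := by
  ext ⟨⟨a, b, c, e, f⟩, g⟩
  simp only [Finset.mem_filter, mem_hexClose, mem_sixStepIndex, Finset.mem_image, sum6]
  constructor
  · rintro ⟨⟨⟨⟨h12, h23, h34, h45⟩, -, hsqB⟩, hsum⟩, ⟨hca, hea⟩, hfb⟩
    subst hea
    have h4 : twoStepV d b + twoStepV d c + twoStepV d f + twoStepV d g = 0 := by
      rw [twoStepV_revIdx] at hsum; rw [← hsum]; abel
    have hfc : f = revIdx c := by
      by_contra hfc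
      exact hfb (eq_revIdx_of_sum_four_eq_zero d h23 hfc h4).1
    subst hfc
    have h2 : twoStepV d b + twoStepV d g = 0 := by
      rw [twoStepV_revIdx] at h4; rw [← h4]; abel
    have hgb : g = revIdx b := twoStepV_add_eq_zero d h2
    refine ⟨(a, b, c), ?_, ?_⟩
    · simp only [hexParam34, Finset.mem_filter, Finset.mem_univ, true_and]
      refine ⟨⟨?_, h12⟩, ?_, hca, ?_, h23⟩
      · rintro rfl; exact hsqB ⟨rfl, rfl⟩
      · intro h; rw [h] at h34; exact h34 rfl
      · rintro rfl; exact hfb rfl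
    · simp only [hexMap3, hgb]
  · rintro ⟨⟨a', b', c'⟩, ht, hEq⟩
    simp only [hexParam34, Finset.mem_filter, Finset.mem_univ, true_and] at ht
    simp only [hexMap3, Prod.mk.injEq] at hEq
    obtain ⟨⟨hba, hba'⟩, hca, hca', hcb, hcb'⟩ := ht
    obtain ⟨⟨rfl, rfl, rfl, rfl, rfl⟩, rfl⟩ := hEq
    refine ⟨⟨⟨⟨hba', hcb', fun h => hca (revIdx_inj h).symm, ?_⟩, fun h => hca' h.1,
      fun h => hba (revIdx_inj h.1).symm⟩, ?_⟩, ⟨hca', rfl⟩, fun h => hcb (revIdx_inj h)⟩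
    · rw [revIdx_revIdx]; exact (ne_revIdx_symm hca').symm
    · rw [twoStepV_revIdx, twoStepV_revIdx, twoStepV_revIdx]; abel

/-- Leaf 4 of `hexClose` (`v₃, v₄ ≠ −v₁`, `v₅ = −v₁`) is the image of `hexMap4`. [cite: MadrasSlade1993, §1.2] -/
theorem hexClose_leaf4 (d : ℕ) :
    (hexClose d).filter (fun p => (¬ p.1.2.2.1 = revIdx p.1.1 ∧ ¬ p.1.2.2.2.1 = revIdx p.1.1) ∧
      p.1.2.2.2.2 = revIdx p.1.1) = (hexParam34 d).image hexMap4 := by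
  ext ⟨⟨a, b, c, e, f⟩, g⟩
  simp only [Finset.mem_filter, mem_hexClose, mem_sixStepIndex, Finset.mem_image, sum6]
  constructor
  · rintro ⟨⟨⟨⟨h12, h23, h34, h45⟩, -, hsqB⟩, hsum⟩, ⟨hca, hea⟩, hfa⟩
    subst hfa
    have h4 : twoStepV d b + twoStepV d c + twoStepV d e + twoStepV d g = 0 := by
      rw [twoStepV_revIdx] at hsum; rw [← hsum]; abel
    obtain ⟨heb, hgc⟩ := eq_revIdx_of_sum_four_eq_zero d h23 h34 h4
    subst heb
    refine ⟨(a, b, c), ?_, ?_⟩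
    · simp only [hexParam34, Finset.mem_filter, Finset.mem_univ, true_and]
      refine ⟨⟨?_, h12⟩, ?_, hca, ?_, h23⟩
      · rintro rfl; exact hea rfl
      · rintro rfl; exact hsqB ⟨rfl, rfl⟩
      · rintro rfl; exact h34 rfl
    · simp only [hexMap4, hgc]
  · rintro ⟨⟨a', b', c'⟩, ht, hEq⟩
    simp only [hexParam34, Finset.mem_filter, Finset.mem_univ, true_and] at ht
    simp only [hexMap4, Prod.mk.injEq] at hEq
    obtain ⟨⟨hba, hba'⟩, hca, hca', hcb, hcb'⟩ := ht
    obtain ⟨⟨rfl, rfl, rfl, rfl, rfl⟩, rfl⟩ := hEq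
    refine ⟨⟨⟨⟨hba', hcb', fun h => hcb (revIdx_inj h).symm, ?_⟩, fun h => hca' h.1,
      fun h => hca (revIdx_inj h.2).symm⟩, ?_⟩, ⟨hca', fun h => hba (revIdx_inj h)⟩, rfl⟩
    · rw [revIdx_revIdx]; exact fun h => hba' h.symm
    · rw [twoStepV_revIdx, twoStepV_revIdx, twoStepV_revIdx]; abel

/-- Leaf 5 of `hexClose` (`v₃, v₄, v₅ ≠ −v₁`) is empty: then `v₆ = −v₁` by the six-vector lemma and steps `2–5` would form a square.
[cite: MadrasSlade1993, §1.2] -/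
theorem hexClose_leaf5 (d : ℕ) :
    (hexClose d).filter (fun p => (¬ p.1.2.2.1 = revIdx p.1.1 ∧ ¬ p.1.2.2.2.1 = revIdx p.1.1) ∧
      ¬ p.1.2.2.2.2 = revIdx p.1.1) = ∅ := by
  refine Finset.filter_eq_empty_iff.2 ?_
  rintro ⟨⟨a, b, c, e, f⟩, g⟩ hp ⟨⟨hca, hea⟩, hfa⟩
  obtain ⟨hs, hsum⟩ := mem_hexClose.1 hp
  obtain ⟨⟨h12, h23, h34, -⟩, -, hsqB⟩ := mem_sixStepIndex.1 hs
  simp only [sum6] at hsum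
  rcases exists_eq_revIdx_of_sum_six_eq_zero d hsum with h | h | h | h | h
  · exact h12 h
  · exact hca h
  · exact hea h
  · exact hfa h
  · subst h
    have h4 : twoStepV d b + twoStepV d c + twoStepV d e + twoStepV d f = 0 := by
      rw [twoStepV_revIdx] at hsum; rw [← hsum]; abel
    exact hsqB (eq_revIdx_of_sum_four_eq_zero d h23 h34 h4)

/-- The hexagon maps are injective. [cite: MadrasSlade1993, §1.2] -/
theorem hexMap_injective (d : ℕ) : Function.Injective (hexMap1 (d := d)) ∧ Function.Injective (hexMap2a (d := d)) ∧
    Function.Injective (hexMap2b (d := d)) ∧ Function.Injective (hexMap3 (d := d)) ∧ Function.Injective (hexMap4 (d := d)) := by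
  refine ⟨?_, ?_, ?_, ?_, ?_⟩
  · rintro ⟨a, b, e⟩ ⟨a', b', e'⟩ h
    simp only [hexMap1, Prod.mk.injEq] at h
    obtain ⟨⟨rfl, rfl, -, rfl, -⟩, -⟩ := h
    rfl
  · rintro ⟨a, c⟩ ⟨a', c'⟩ h
    simp only [hexMap2a, Prod.mk.injEq] at h
    obtain ⟨⟨rfl, -, rfl, -, -⟩, -⟩ := h
    rfl
  · rintro ⟨a, b, c⟩ ⟨a', b', c'⟩ h
    simp only [hexMap2b, Prod.mk.injEq] at h
    obtain ⟨⟨rfl, rfl, rfl, -, -⟩, -⟩ := h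
    rfl
  · rintro ⟨a, b, c⟩ ⟨a', b', c'⟩ h
    simp only [hexMap3, Prod.mk.injEq] at h
    obtain ⟨⟨rfl, rfl, rfl, -, -⟩, -⟩ := h
    rfl
  · rintro ⟨a, b, c⟩ ⟨a', b', c'⟩ h
    simp only [hexMap4, Prod.mk.injEq] at h
    obtain ⟨⟨rfl, rfl, rfl, -, -⟩, -⟩ := h
    rfl

/-- `#{(a, b) : b ∉ {a, −a}} · k`-type nested count: `Σ_a Σ_b [b ∉ {a,−a}]·k = 2d(2d−2)k`. [cite: MadrasSlade1993, §1.2] -/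
theorem sum_sum_ne_pair (d k : ℕ) :
    (∑ a : Idx d, ∑ b : Idx d, if (b ≠ a ∧ b ≠ revIdx a) then k else 0) = 2 * d * (2 * d - 2) * k := by
  have : ∀ a : Idx d, (∑ b : Idx d, if (b ≠ a ∧ b ≠ revIdx a) then k else 0) = (2 * d - 2) * k := by
    intro a; rw [sum_ite_const_nat, card_filter_ne_ne_idx d (revIdx_ne_self a).symm]
  rw [Finset.sum_congr rfl fun a _ => this a, Finset.sum_const, smul_eq_mul, Finset.card_univ, card_idx]; ring

/-- `#hexParam1 = 2d(2d−2)(2d−3)`. [cite: MadrasSlade1993, §1.2] -/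
theorem card_hexParam1 (d : ℕ) : (hexParam1 d).card = 2 * d * (2 * d - 2) * (2 * d - 3) := by
  have inner : ∀ a : Idx d, (Finset.univ.filter fun t : Idx d × Idx d =>
      (t.1 ≠ a ∧ t.1 ≠ revIdx a) ∧ (t.2 ≠ a ∧ t.2 ≠ t.1 ∧ t.2 ≠ revIdx t.1)).card =
      ∑ b : Idx d, if (b ≠ a ∧ b ≠ revIdx a) then 2 * d - 3 else 0 := by
    intro a
    rw [card_filter_univ_prod]
    refine Finset.sum_congr rfl fun b _ => ?_
    dsimp only
    by_cases hb : (b ≠ a ∧ b ≠ revIdx a)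
    · rw [if_pos hb, Finset.filter_congr (q := fun e : Idx d => e ≠ a ∧ e ≠ b ∧ e ≠ revIdx b) fun e _ => by simp [hb]]
      exact card_filter_ne_three_idx d (Ne.symm hb.1) (ne_revIdx_symm hb.2) (revIdx_ne_self b).symm
    · rw [if_neg hb]; exact Finset.card_eq_zero.2 (Finset.filter_eq_empty_iff.2 fun e _ h => hb h.1)
  rw [hexParam1, card_filter_univ_prod]
  exact (Finset.sum_congr rfl fun a _ => inner a).trans (sum_sum_ne_pair d (2 * d - 3))

/-- `#hexParam2a = 2d(2d−2)`. [cite: MadrasSlade1993, §1.2] -/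
theorem card_hexParam2a (d : ℕ) : (hexParam2a d).card = 2 * d * (2 * d - 2) := by
  rw [hexParam2a, card_filter_univ_prod]
  have : ∀ a : Idx d, (Finset.univ.filter fun c : Idx d => c ≠ a ∧ c ≠ revIdx a).card = 2 * d - 2 := fun a =>
    card_filter_ne_ne_idx d (revIdx_ne_self a).symm
  rw [Finset.sum_congr rfl fun a _ => this a, Finset.sum_const, smul_eq_mul, Finset.card_univ, card_idx]

/-- `#hexParam2b = 2d(2d−2)(2d−3)`. [cite: MadrasSlade1993, §1.2] -/
theorem card_hexParam2b (d : ℕ) : (hexParam2b d).card = 2 * d * (2 * d - 2) * (2 * d - 3) := by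
  have inner : ∀ a : Idx d, (Finset.univ.filter fun t : Idx d × Idx d =>
      (t.1 ≠ a ∧ t.1 ≠ revIdx a) ∧ (t.2 ≠ a ∧ t.2 ≠ revIdx a ∧ t.2 ≠ revIdx t.1)).card =
      ∑ b : Idx d, if (b ≠ a ∧ b ≠ revIdx a) then 2 * d - 3 else 0 := by
    intro a
    rw [card_filter_univ_prod]
    refine Finset.sum_congr rfl fun b _ => ?_
    dsimp only
    by_cases hb : (b ≠ a ∧ b ≠ revIdx a)
    · rw [if_pos hb, Finset.filter_congr (q := fun e : Idx d => e ≠ a ∧ e ≠ revIdx a ∧ e ≠ revIdx b) fun e _ => by simp [hb]]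
      exact card_filter_ne_three_idx d (revIdx_ne_self a).symm (ne_revIdx_symm hb.2) fun h => hb.1 (revIdx_inj h).symm
    · rw [if_neg hb]; exact Finset.card_eq_zero.2 (Finset.filter_eq_empty_iff.2 fun e _ h => hb h.1)
  rw [hexParam2b, card_filter_univ_prod]
  exact (Finset.sum_congr rfl fun a _ => inner a).trans (sum_sum_ne_pair d (2 * d - 3))

/-- `#hexParam34 = 2d(2d−2)(2d−4)`. [cite: MadrasSlade1993, §1.2] -/
theorem card_hexParam34 (d : ℕ) : (hexParam34 d).card = 2 * d * (2 * d - 2) * (2 * d - 4) := by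
  have inner : ∀ a : Idx d, (Finset.univ.filter fun t : Idx d × Idx d =>
      (t.1 ≠ a ∧ t.1 ≠ revIdx a) ∧ (t.2 ≠ a ∧ t.2 ≠ revIdx a ∧ t.2 ≠ t.1 ∧ t.2 ≠ revIdx t.1)).card =
      ∑ b : Idx d, if (b ≠ a ∧ b ≠ revIdx a) then 2 * d - 4 else 0 := by
    intro a
    rw [card_filter_univ_prod]
    refine Finset.sum_congr rfl fun b _ => ?_
    dsimp only
    by_cases hb : (b ≠ a ∧ b ≠ revIdx a)
    · rw [if_pos hb, Finset.filter_congr (q := fun e : Idx d => e ≠ a ∧ e ≠ revIdx a ∧ e ≠ b ∧ e ≠ revIdx b)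
        fun e _ => by simp [hb]]
      exact card_filter_ne_four_idx d (revIdx_ne_self a).symm (Ne.symm hb.1) (ne_revIdx_symm hb.2)
        (fun h => hb.2 h.symm) (fun h => hb.1 (revIdx_inj h).symm) (revIdx_ne_self b).symm
    · rw [if_neg hb]; exact Finset.card_eq_zero.2 (Finset.filter_eq_empty_iff.2 fun e _ h => hb h.1)
  rw [hexParam34, card_filter_univ_prod]
  exact (Finset.sum_congr rfl fun a _ => inner a).trans (sum_sum_ne_pair d (2 * d - 4))

/-- ★ `#hexClose = 2d(2d−2)(8d−13)`: the rooted directed six-step self-avoiding polygons of `ℤ^d` (`d = 2, 3`: `24`, `264`; i.e. `12 p_6`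
with `p_6 = 2, 22`). [cite: MadrasSlade1993, §1.2; Appendix C, Table C.1] -/
theorem card_hexClose (d : ℕ) : (hexClose d).card = 2 * d * (2 * d - 2) * (8 * d - 13) := by
  classical
  have s1 := Finset.card_filter_add_card_filter_not (s := hexClose d) (fun p => p.1.2.2.1 = revIdx p.1.1)
  have s2 := Finset.card_filter_add_card_filter_not (s := (hexClose d).filter fun p => ¬ p.1.2.2.1 = revIdx p.1.1)
    (fun p => p.1.2.2.2.1 = revIdx p.1.1)
  have s3 := Finset.card_filter_add_card_filter_not
    (s := ((hexClose d).filter fun p => ¬ p.1.2.2.1 = revIdx p.1.1).filter fun p => p.1.2.2.2.1 = revIdx p.1.1)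
    (fun p => p.1.2.2.2.2 = revIdx p.1.2.1)
  have s4 := Finset.card_filter_add_card_filter_not
    (s := (((hexClose d).filter fun p => ¬ p.1.2.2.1 = revIdx p.1.1).filter fun p => p.1.2.2.2.1 = revIdx p.1.1).filter
      fun p => p.1.2.2.2.2 = revIdx p.1.2.1) (fun p => p.1.2.1 = p.1.1)
  have s5 := Finset.card_filter_add_card_filter_not
    (s := ((hexClose d).filter fun p => ¬ p.1.2.2.1 = revIdx p.1.1).filter fun p => ¬ p.1.2.2.2.1 = revIdx p.1.1)
    (fun p => p.1.2.2.2.2 = revIdx p.1.1)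
  simp only [Finset.filter_filter] at s1 s2 s3 s4 s5
  rw [hexClose_leaf1, Finset.card_image_of_injective _ (hexMap_injective d).1, card_hexParam1] at s1
  rw [hexClose_leaf2a, Finset.card_image_of_injective _ (hexMap_injective d).2.1, card_hexParam2a,
    hexClose_leaf2b, Finset.card_image_of_injective _ (hexMap_injective d).2.2.1, card_hexParam2b] at s4
  rw [hexClose_leaf3, Finset.card_image_of_injective _ (hexMap_injective d).2.2.2.1, card_hexParam34] at s3
  rw [hexClose_leaf4, Finset.card_image_of_injective _ (hexMap_injective d).2.2.2.2, card_hexParam34, hexClose_leaf5,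
    Finset.card_empty] at s5
  rcases Nat.lt_or_ge d 2 with hd | hd
  · interval_cases d <;> omega
  · obtain ⟨k, rfl⟩ := Nat.exists_eq_add_of_le hd
    have e2 : 2 * (2 + k) - 2 = 2 * k + 2 := by omega
    have e3 : 2 * (2 + k) - 3 = 2 * k + 1 := by omega
    have e4 : 2 * (2 + k) - 4 = 2 * k := by omega
    have e5 : 8 * (2 + k) - 13 = 8 * k + 3 := by omega
    simp only [e2, e3, e4] at s1 s3 s4 s5
    rw [e2, e5]
    ring_nf at s1 s3 s4 s5 ⊢
    linarith

/-! ### The three excluded families are pairwise disjoint -/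

/-- `#(revClose ∪ sqClose ∪ hexClose) = #revClose + #sqClose + #hexClose`. [cite: MadrasSlade1993, §1.2] -/
theorem card_bad (d : ℕ) :
    (revClose d ∪ sqClose d ∪ hexClose d).card = (revClose d).card + (sqClose d).card + (hexClose d).card := by
  have h1 : Disjoint (revClose d) (sqClose d) := by
    rw [Finset.disjoint_left]
    rintro ⟨⟨a, b, c, e, f⟩, g⟩ hr hq
    obtain ⟨hs, hg⟩ := mem_revClose.1 hr
    obtain ⟨-, hsum⟩ := mem_sqClose.1 hq
    obtain ⟨⟨-, -, h34, -⟩, -, -⟩ := mem_sixStepIndex.1 hs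
    simp only at hg
    subst hg
    simp only [sum4] at hsum
    rw [twoStepV_revIdx] at hsum
    have h2 : twoStepV d c + twoStepV d e = 0 := by rw [← hsum]; abel
    exact h34 (twoStepV_add_eq_zero d h2)
  have h2 : Disjoint (revClose d) (hexClose d) := by
    rw [Finset.disjoint_left]
    rintro ⟨⟨a, b, c, e, f⟩, g⟩ hr hx
    obtain ⟨hs, hg⟩ := mem_revClose.1 hr
    obtain ⟨-, hsum⟩ := mem_hexClose.1 hx
    obtain ⟨⟨h12, h23, -, -⟩, hsqA, -⟩ := mem_sixStepIndex.1 hs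
    simp only at hg
    subst hg
    simp only [sum6] at hsum
    rw [twoStepV_revIdx] at hsum
    have h4 : twoStepV d a + twoStepV d b + twoStepV d c + twoStepV d e = 0 := by rw [← hsum]; abel
    exact hsqA (eq_revIdx_of_sum_four_eq_zero d h12 h23 h4)
  have h3 : Disjoint (sqClose d) (hexClose d) := by
    rw [Finset.disjoint_left]
    rintro ⟨⟨a, b, c, e, f⟩, g⟩ hq hx
    obtain ⟨hs, hsum4⟩ := mem_sqClose.1 hq
    obtain ⟨-, hsum⟩ := mem_hexClose.1 hx
    obtain ⟨⟨h12, -, -, -⟩, -, -⟩ := mem_sixStepIndex.1 hs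
    simp only [sum4] at hsum4
    simp only [sum6] at hsum
    have h2 : twoStepV d a + twoStepV d b = 0 := by
      have : twoStepV d a + twoStepV d b + (twoStepV d c + twoStepV d e + twoStepV d f + twoStepV d g) = 0 := by
        rw [← hsum]; abel
      rwa [hsum4, add_zero] at this
    exact h12 (twoStepV_add_eq_zero d h2)
  rw [Finset.card_union_of_disjoint (Finset.disjoint_union_left.2 ⟨h2, h3⟩), Finset.card_union_of_disjoint h1]

/-- ★ `#sevenIndex + #sixStepIndex + 2d(2d−1)(2d−2)² + 2d(2d−2)(8d−13) = 2d · #sixStepIndex`. [cite: MadrasSlade1993, §1.2] -/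
theorem card_sevenIndex_eq (d : ℕ) : (sevenIndex d).card + (sixStepIndex d).card + 2 * d * (2 * d - 1) * (2 * d - 2) ^ 2 +
    2 * d * (2 * d - 2) * (8 * d - 13) = (sixStepIndex d).card * (2 * d) := by
  rw [← card_sevenIndex_add d, card_bad, card_revClose, card_sqClose, card_hexClose]; ring

/-! ### The cost-six irreducible bridges of length seven -/

/-- Membership in `sevenIndex`. [cite: MadrasSlade1993, §1.2] -/
theorem mem_sevenIndex {d : ℕ} {p : Idx5 d × Idx d} : p ∈ sevenIndex d ↔
    p.1 ∈ sixStepIndex d ∧ p.2 ≠ revIdx p.1.2.2.2.2 ∧ sum4 d p ≠ 0 ∧ sum6 d p ≠ 0 := by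
  rw [sevenIndex, Finset.mem_filter, mem_ext6, not_or, not_or]

/-- The seven-step walk `(0, e₀, e₀+v₁, …, e₀+v₁+⋯+v₆)`: `sixStep s` extended by `v₆ = v_g`. [cite: MadrasSlade1993, Definition 1.2.4] -/
def sevenStep (d : ℕ) (p : Idx5 d × Idx d) : ℕ → Site (d + 1) :=
  fun i => if i ≤ 6 then sixStep d p.1 i else sixStep d p.1 6 + twoStepV d p.2

/-- `sevenStep` agrees with `sixStep` up to time `6`. [cite: MadrasSlade1993, Definition 1.2.4] -/
theorem sevenStep_of_le_six (d : ℕ) (p : Idx5 d × Idx d) {i : ℕ} (hi : i ≤ 6) : sevenStep d p i = sixStep d p.1 i := by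
  simp [sevenStep, hi]

/-- Value at `i ≥ 7`. [cite: MadrasSlade1993, Definition 1.2.4] -/
theorem sevenStep_of_seven_le (d : ℕ) (p : Idx5 d × Idx d) {i : ℕ} (hi : 7 ≤ i) :
    sevenStep d p i = sixStep d p.1 6 + twoStepV d p.2 := by
  simp [sevenStep, show ¬ i ≤ 6 by omega]

/-- Heights along `sevenStep`: `0, 1, 1, …`. [cite: MadrasSlade1993, Definition 1.2.4] -/
theorem sevenStep_apply_zero (d : ℕ) (p : Idx5 d × Idx d) (i : ℕ) : sevenStep d p i 0 = if i = 0 then 0 else 1 := by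
  rcases Nat.lt_or_ge i 7 with hi | hi
  · rw [sevenStep_of_le_six d p (by omega), sixStep_apply_zero]
  · rw [sevenStep_of_seven_le d p hi, Pi.add_apply, sixStep_apply_zero, twoStepV_apply_zero, if_neg (by norm_num), if_neg (by omega),
      add_zero]

/-- `sevenStep p`, `p ∈ sevenIndex`, is a seven-step self-avoiding walk. [cite: MadrasSlade1993, Definition 1.2.4] -/
theorem sevenStep_mem_saws (d : ℕ) {p : Idx5 d × Idx d} (hp : p ∈ sevenIndex d) : sevenStep d p ∈ saws (d + 1) 7 := by
  obtain ⟨⟨a, b, c, e, f⟩, g⟩ := p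
  obtain ⟨hs, hgf, hsq, hhex⟩ := mem_sevenIndex.1 hp
  obtain ⟨⟨-, -, -, h45⟩, -, -⟩ := mem_sixStepIndex.1 hs
  obtain ⟨h0, -, hadj, hinj⟩ := mem_saws.1 (sixStep_mem_saws d hs)
  simp only at hgf hsq hhex
  simp only [sum4] at hsq
  simp only [sum6] at hhex
  refine mem_saws.2 ⟨by rw [sevenStep_of_le_six d _ (by norm_num), h0], fun i hi => ?_, fun i hi => ?_, ?_⟩
  · rw [sevenStep_of_seven_le d _ hi, sevenStep_of_seven_le d _ le_rfl]
  · rcases Nat.lt_or_ge i 6 with hi6 | hi6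
    · rw [sevenStep_of_le_six d _ hi6.le, sevenStep_of_le_six d _ (by omega)]; exact hadj i hi6
    · have hi' : i = 6 := by omega
      subst hi'
      rw [sevenStep_of_le_six d _ le_rfl, sevenStep_of_seven_le d _ le_rfl]; exact adj_add_twoStepV d _ _
  · -- injectivity: pairs inside `[0, 6]` from `sixStep`, pairs `(i, 7)` by hand
    have h7 : ∀ i, i ≤ 6 → sevenStep d ((a, b, c, e, f), g) i ≠ sevenStep d ((a, b, c, e, f), g) 7 := by
      intro i hi h
      rw [sevenStep_of_le_six d _ hi, sevenStep_of_seven_le d _ le_rfl] at h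
      simp only at h
      have hi0 : i ≠ 0 := by
        rintro rfl
        have hh := congrFun h 0
        rw [sixStep_apply_zero, Pi.add_apply, sixStep_apply_zero, twoStepV_apply_zero, if_pos rfl, if_neg (by norm_num)] at hh
        norm_num at hh
      have key : i = 1 ∨ i = 2 ∨ i = 3 ∨ i = 4 ∨ i = 5 ∨ i = 6 := by omega
      rw [sixStep_of_six_le d _ le_rfl] at h
      rcases key with rfl | rfl | rfl | rfl | rfl | rfl
      · rw [sixStep_one] at h
        have h' : twoStepV d a + twoStepV d b + twoStepV d c + twoStepV d e + twoStepV d f + twoStepV d g = 0 := by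
          have := h.symm; rw [← sub_eq_zero] at this; rw [← this]; abel
        exact hhex h'
      · rw [sixStep_two] at h
        have h' : twoStepV d b + twoStepV d c + twoStepV d e + twoStepV d f + twoStepV d g = 0 := by
          have := h.symm; rw [← sub_eq_zero] at this; rw [← this]; abel
        exact twoStepV_sum_five_ne_zero d _ _ _ _ _ h'
      · rw [sixStep_three] at h
        have h' : twoStepV d c + twoStepV d e + twoStepV d f + twoStepV d g = 0 := by
          have := h.symm; rw [← sub_eq_zero] at this; rw [← this]; abel
        exact hsq h'
      · rw [sixStep_four] at h
        have h' : twoStepV d e + twoStepV d f + twoStepV d g = 0 := by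
          have := h.symm; rw [← sub_eq_zero] at this; rw [← this]; abel
        exact twoStepV_add_add_ne_zero d _ _ _ h'
      · rw [sixStep_five] at h
        have h' : twoStepV d f + twoStepV d g = 0 := by
          have := h.symm; rw [← sub_eq_zero] at this; rw [← this]; abel
        exact hgf (twoStepV_add_eq_zero d h')
      · rw [sixStep_of_six_le d _ le_rfl] at h
        have h' : twoStepV d g = 0 := by
          have := h.symm; rw [← sub_eq_zero] at this; rw [← this]; abel
        exact twoStepV_ne_zero d g h'
    intro i hi j hj h
    simp only [Set.mem_setOf_eq] at hi hj
    rcases Nat.lt_or_ge i 7 with hi7 | hi7 <;> rcases Nat.lt_or_ge j 7 with hj7 | hj7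
    · rw [sevenStep_of_le_six d _ (by omega), sevenStep_of_le_six d _ (by omega)] at h
      exact hinj (show i ∈ {k : ℕ | k ≤ 6} from by simp; omega) (show j ∈ {k : ℕ | k ≤ 6} from by simp; omega) h
    · have hj' : j = 7 := by omega
      subst hj'
      exact absurd h (h7 i (by omega))
    · have hi' : i = 7 := by omega
      subst hi'
      exact absurd h.symm (h7 j (by omega))
    · omega

/-- `sevenStep p` is an irreducible bridge of cost six. [cite: DuminilCopinHammond2013, §2.2] -/
theorem sevenStep_mem_filter (d : ℕ) {p : Idx5 d × Idx d} (hp : p ∈ sevenIndex d) :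
    sevenStep d p ∈ (irreducibleBridges (d + 1) 7).filter fun ω => costZd d 7 ω = 6 := by
  have hb : IsBridge 7 (sevenStep d p) := by
    intro i h1 h2
    rw [sevenStep_apply_zero, sevenStep_apply_zero, sevenStep_apply_zero, if_pos rfl, if_neg (by omega), if_neg (by omega)]
    exact ⟨zero_lt_one, le_rfl⟩
  refine Finset.mem_filter.2 ⟨mem_irreducibleBridges.2 ⟨mem_bridges.2 ⟨sevenStep_mem_saws d hp, hb⟩,
    ⟨by norm_num, hb, fun k hk1 hk2 hren => ?_⟩⟩, ?_⟩
  · have h := (hren.2.2 1 le_rfl (by omega)).1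
    simp only [add_zero, sevenStep_apply_zero] at h
    have hk0 : k ≠ 0 := by omega
    have hk1' : k + 1 ≠ 0 := by omega
    rw [if_neg hk0, if_neg hk1'] at h
    exact lt_irrefl _ h
  · simp [costZd, sevenStep_apply_zero]

/-- ★ **Every cost-six irreducible bridge of length seven is a `sevenStep`** (span one; self-avoidance gives the index conditions).
[cite: MadrasSlade1993, Definition 1.2.4] -/
theorem eq_sevenStep_of_mem (d : ℕ) {ω : ℕ → Site (d + 1)}
    (hω : ω ∈ (irreducibleBridges (d + 1) 7).filter fun ω => costZd d 7 ω = 6) : ∃ p ∈ sevenIndex d, ω = sevenStep d p := by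
  obtain ⟨hirr, hcost⟩ := Finset.mem_filter.1 hω
  obtain ⟨hbr, -⟩ := mem_irreducibleBridges.1 hirr
  obtain ⟨hωs, hb⟩ := mem_bridges.1 hbr
  obtain ⟨h0, hend, hadj, hinj⟩ := mem_saws.1 hωs
  have hω1 : ω 1 = Pi.single 0 1 := apply_one_eq_e0_of_mem_bridges d (by norm_num) hbr
  have h7eq : ω 7 0 = 1 := by
    have hc : costZd d 7 ω = 6 := hcost
    simp only [costZd] at hc
    have := (span_le_and_cost_bound_zd hirr).1
    have h70 : 0 < ω 7 0 := by have := (hb 7 (by norm_num) le_rfl).1; rwa [h0] at this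
    omega
  have h1eq : ω 1 0 = 1 := by rw [hω1]; simp
  have hieq : ∀ i, 1 ≤ i → i ≤ 7 → ω i 0 = 1 := by
    intro i hi1 hi7
    have h := hb i hi1 hi7
    rw [h0, h7eq] at h
    simp only [Pi.zero_apply] at h
    omega
  obtain ⟨a, ha⟩ := exists_twoStepV_of_adj d (hadj 1 (by norm_num)) (by rw [hieq 2 (by norm_num) (by norm_num), h1eq])
  obtain ⟨b, hb'⟩ := exists_twoStepV_of_adj d (hadj 2 (by norm_num))
    (by rw [hieq 3 (by norm_num) (by norm_num), hieq 2 (by norm_num) (by norm_num)])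
  obtain ⟨c, hc'⟩ := exists_twoStepV_of_adj d (hadj 3 (by norm_num))
    (by rw [hieq 4 (by norm_num) (by norm_num), hieq 3 (by norm_num) (by norm_num)])
  obtain ⟨e, he'⟩ := exists_twoStepV_of_adj d (hadj 4 (by norm_num))
    (by rw [hieq 5 (by norm_num) (by norm_num), hieq 4 (by norm_num) (by norm_num)])
  obtain ⟨f, hf'⟩ := exists_twoStepV_of_adj d (hadj 5 (by norm_num))
    (by rw [hieq 6 (by norm_num) (by norm_num), hieq 5 (by norm_num) (by norm_num)])
  obtain ⟨g, hg'⟩ := exists_twoStepV_of_adj d (hadj 6 (by norm_num))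
    (by rw [hieq 7 (by norm_num) le_rfl, hieq 6 (by norm_num) (by norm_num)])
  have hmem : ∀ i : ℕ, i ≤ 7 → i ∈ {j : ℕ | j ≤ 7} := fun i hi => hi
  have hab : b ≠ revIdx a := by
    intro hba
    have h13 : ω 3 = ω 1 := by rw [hb', ha, hba, twoStepV_revIdx, add_assoc, add_neg_cancel, add_zero]
    have := hinj (hmem 3 (by norm_num)) (hmem 1 (by norm_num)) h13
    omega
  have hbc : c ≠ revIdx b := by
    intro hcb
    have h24 : ω 4 = ω 2 := by rw [hc', hb', hcb, twoStepV_revIdx, add_assoc, add_neg_cancel, add_zero]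
    have := hinj (hmem 4 (by norm_num)) (hmem 2 (by norm_num)) h24
    omega
  have hce : e ≠ revIdx c := by
    intro hec
    have h35 : ω 5 = ω 3 := by rw [he', hc', hec, twoStepV_revIdx, add_assoc, add_neg_cancel, add_zero]
    have := hinj (hmem 5 (by norm_num)) (hmem 3 (by norm_num)) h35
    omega
  have hef : f ≠ revIdx e := by
    intro hfe
    have h46 : ω 6 = ω 4 := by rw [hf', he', hfe, twoStepV_revIdx, add_assoc, add_neg_cancel, add_zero]
    have := hinj (hmem 6 (by norm_num)) (hmem 4 (by norm_num)) h46
    omega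
  have hfg : g ≠ revIdx f := by
    intro hgf
    have h57 : ω 7 = ω 5 := by rw [hg', hf', hgf, twoStepV_revIdx, add_assoc, add_neg_cancel, add_zero]
    have := hinj (hmem 7 le_rfl) (hmem 5 (by norm_num)) h57
    omega
  have hsqA : ¬ (c = revIdx a ∧ e = revIdx b) := by
    rintro ⟨hca, heb⟩
    have h15 : ω 5 = ω 1 := by
      rw [he', hc', hb', ha, hca, heb, twoStepV_revIdx, twoStepV_revIdx]
      abel
    have := hinj (hmem 5 (by norm_num)) (hmem 1 (by norm_num)) h15
    omega
  have hsqB : ¬ (e = revIdx b ∧ f = revIdx c) := by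
    rintro ⟨heb, hfc⟩
    have h26 : ω 6 = ω 2 := by
      rw [hf', he', hc', hb', heb, hfc, twoStepV_revIdx, twoStepV_revIdx]
      abel
    have := hinj (hmem 6 (by norm_num)) (hmem 2 (by norm_num)) h26
    omega
  have hsqC : twoStepV d c + twoStepV d e + twoStepV d f + twoStepV d g ≠ 0 := by
    intro h4
    have h37 : ω 7 = ω 3 := by
      rw [hg', hf', he', hc']
      have : ω 3 + twoStepV d c + twoStepV d e + twoStepV d f + twoStepV d g =
          ω 3 + (twoStepV d c + twoStepV d e + twoStepV d f + twoStepV d g) := by abel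
      rw [this, h4, add_zero]
    have := hinj (hmem 7 le_rfl) (hmem 3 (by norm_num)) h37
    omega
  have hhex : twoStepV d a + twoStepV d b + twoStepV d c + twoStepV d e + twoStepV d f + twoStepV d g ≠ 0 := by
    intro h6
    have h17 : ω 7 = ω 1 := by
      rw [hg', hf', he', hc', hb', ha]
      have : ω 1 + twoStepV d a + twoStepV d b + twoStepV d c + twoStepV d e + twoStepV d f + twoStepV d g =
          ω 1 + (twoStepV d a + twoStepV d b + twoStepV d c + twoStepV d e + twoStepV d f + twoStepV d g) := by abel
      rw [this, h6, add_zero]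
    have := hinj (hmem 7 le_rfl) (hmem 1 (by norm_num)) h17
    omega
  refine ⟨((a, b, c, e, f), g), mem_sevenIndex.2 ⟨mem_sixStepIndex.2 ⟨⟨hab, hbc, hce, hef⟩, hsqA, hsqB⟩, hfg, hsqC, hhex⟩,
    funext fun i => ?_⟩
  rcases Nat.lt_or_ge i 7 with hi7 | hi7
  · rw [sevenStep_of_le_six d _ (by omega)]
    interval_cases i
    · rw [h0, sixStep_zero]
    · rw [hω1, sixStep_one]
    · rw [ha, hω1, sixStep_two]
    · rw [hb', ha, hω1, sixStep_three]
    · rw [hc', hb', ha, hω1, sixStep_four]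
    · rw [he', hc', hb', ha, hω1, sixStep_five]
    · rw [hf', he', hc', hb', ha, hω1, sixStep_of_six_le d _ le_rfl]
  · rw [hend i hi7, sevenStep_of_seven_le d _ hi7, hg', hf', he', hc', hb', ha, hω1, sixStep_of_six_le d _ le_rfl]

/-- `sevenStep` is injective. [cite: MadrasSlade1993, Definition 1.2.4] -/
theorem sevenStep_injective (d : ℕ) : Function.Injective (sevenStep d) := by
  rintro ⟨s, g⟩ ⟨s', g'⟩ h
  have h6 : sixStep d s = sixStep d s' := by
    funext i
    rcases Nat.lt_or_ge i 6 with hi | hi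
    · have := congrFun h i
      rwa [sevenStep_of_le_six d _ (by omega), sevenStep_of_le_six d _ (by omega)] at this
    · have := congrFun h 6
      rw [sevenStep_of_le_six d _ le_rfl, sevenStep_of_le_six d _ le_rfl] at this
      simp only at this
      rw [sixStep_of_six_le d _ hi, sixStep_of_six_le d _ hi, ← sixStep_of_six_le d s le_rfl, ← sixStep_of_six_le d s' le_rfl, this]
  have hs : s = s' := sixStep_injective d h6
  subst hs
  have h7 := congrFun h 7
  rw [sevenStep_of_seven_le d _ le_rfl, sevenStep_of_seven_le d _ le_rfl] at h7
  simp only [add_right_inj] at h7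
  rw [twoStepV_injective d h7]

/-- ★ The cost-six irreducible bridges of length seven are exactly the `sevenStep`s. [cite: MadrasSlade1993, §4.2] -/
theorem filter_costZd_six_seven_eq_image (d : ℕ) [DecidableEq (ℕ → Site (d + 1))] :
    ((irreducibleBridges (d + 1) 7).filter fun ω => costZd d 7 ω = 6) = (sevenIndex d).image (sevenStep d) := by
  ext ω
  constructor
  · intro h
    obtain ⟨p, hp, rfl⟩ := eq_sevenStep_of_mem d h
    exact Finset.mem_image_of_mem _ hp
  · intro h
    obtain ⟨p, hp, rfl⟩ := Finset.mem_image.1 h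
    exact sevenStep_mem_filter d hp

/-- ★ **`N_{6,7} + N_{5,6} + 2d(2d−1)(2d−2)² + 2d(2d−2)(8d−13) = 2d · N_{5,6}`** on `ℤ^{d+1}` (subtraction-free): a six-step self-avoiding
walk of `ℤ^d` is a five-step one extended by one of `2d` steps, minus the reversals, the square closers and the hexagon closers.
[cite: MadrasSlade1993, §1.2; Appendix C, Table C.1] -/
theorem costCoeffZd_six_seven_add (d : ℕ) : costCoeffZd d 6 7 + costCoeffZd d 5 6 + 2 * d * (2 * d - 1) * (2 * d - 2) ^ 2 +
    2 * d * (2 * d - 2) * (8 * d - 13) = 2 * d * costCoeffZd d 5 6 := by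
  classical
  have hS : (sixStepIndex d).card = costCoeffZd d 5 6 := by
    rw [costCoeffZd, filter_costZd_five_six_eq_image, Finset.card_image_of_injective _ (sixStep_injective d)]
  have h67 : costCoeffZd d 6 7 = (sevenIndex d).card := by
    rw [costCoeffZd, filter_costZd_six_seven_eq_image, Finset.card_image_of_injective _ (sevenStep_injective d)]
  rw [h67, ← hS, Nat.mul_comm (2 * d) (sixStepIndex d).card]
  exact card_sevenIndex_eq d

/-- ★ **`N_{6,7} + 160d⁵ + 34d = 64d⁶ + 112d⁴ + 20d²`** (subtraction-free closed form). [cite: MadrasSlade1993, Appendix C, Table C.1] -/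
theorem costCoeffZd_six_seven_add' (d : ℕ) : costCoeffZd d 6 7 + 160 * d ^ 5 + 34 * d = 64 * d ^ 6 + 112 * d ^ 4 + 20 * d ^ 2 := by
  have h1 := costCoeffZd_six_seven_add d
  have h2 := costCoeffZd_five_six_add d
  -- keep the censuses opaque (no closed `costCoeffZd 0 6 7` for the kernel to unfold)
  generalize costCoeffZd d 6 7 = N at h1 ⊢
  generalize costCoeffZd d 5 6 = M at h1 h2
  rcases Nat.lt_or_ge d 2 with hd | hd
  · interval_cases d
    · norm_num at h1 ⊢; omega
    · norm_num at h1 h2 ⊢; omega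
  · obtain ⟨k, rfl⟩ := Nat.exists_eq_add_of_le hd
    have e1 : 2 * (2 + k) - 1 = 2 * k + 3 := by omega
    have e2 : 2 * (2 + k) - 2 = 2 * k + 2 := by omega
    have e3 : 4 * (2 + k) - 3 = 4 * k + 5 := by omega
    have e5 : 8 * (2 + k) - 13 = 8 * k + 3 := by omega
    rw [e1, e2, e5] at h1
    rw [e1, e2, e3] at h2
    linear_combination h1 + (2 * k + 3) * h2

/-- ★ **`N_{6,7} = 64d⁶ − 160d⁵ + 112d⁴ + 20d² − 34d`**, the number of six-step self-avoiding walks of `ℤ^d` (`d = 1, …, 6`: `2`, `780`,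
`16 926`, `127 160`, `570 330`, `1 887 492` — Table C.1 p. 394 for `d = 2, 3`, Table C.4 p. 397 for `d = 4, 5, 6`; the positive terms are grouped
first so that truncated subtraction in `ℕ` is harmless for every `d`). [cite: MadrasSlade1993, Appendix C, Table C.1 (p. 394) and Table C.4 (p. 397)] -/
theorem costCoeffZd_six_seven (d : ℕ) : costCoeffZd d 6 7 = 64 * d ^ 6 + 112 * d ^ 4 + 20 * d ^ 2 - 160 * d ^ 5 - 34 * d := by
  have h := costCoeffZd_six_seven_add' d
  omega

end Literature.Probability.RandomPlanarGeometry.SAW.Zd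

end
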